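import Summits.CriticalPhenomena.PercolationContinuityZ3.Theorems.PercNearOneGluingAdditiveGluingSetGlueK0
import Summits.CriticalPhenomena.PercolationContinuityZ3.Theorems.PercNearOneGluingAdditiveGluingSetGlueHalf
import HarnessLib

/-!
# Crux `PercNearOneGluing.AdditiveGluing` (stmt-CriticalPhenomena-4576): the crux from the WEAKER set kernel (II′-set) (branch-2 form)

Support file (`--supports stmt-CriticalPhenomena-4576`; lead-of-record prim-png-lead-4576, gen 2).  No definitions, no named facts, no sorries.
The set-gluing reduction (`…SetGlueK0.lean`, skeleton v22) consumes, at each induction step, only the branch-2 inequality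

  **(II′-set)**  `μ(CSᶜ ∩ o↔c)·(μ(BS) − τ_c − μ(Γ_c)) ≤ μ(CSᶜ)·(μ(BS) − θ + ROOM_S − μ(Γ_o))`,   `θ = τ(s₀) = min_{S ∪ {c}} τ`,

(notation of `…SetGlueK0.lean`; `ROOM_S = μ((o↔c ∪ OS)ᶜ ∩ c↔b ∩ BSᶜ)`), which (K₀-set) implies (`cag_insert_of_k0setHalf`) but which is strictly
weaker in practice: its extra budget `μ(CSᶜ∩oc)·(τ_c − θ) + μ(CSᶜ)·ROOM_S` absorbs most of the non-telescoping excess of chains of set-pair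
kernel steps (lead memo LeadMath-g2 §8).  This file records the reduction with (II′-set) itself as the `|S| ≥ 3` kernel, so that provers may target
the weaker statement: registered alternative stub `stub_b2set3_g2` (= hypothesis `hB` of `additiveGluing_of_b2set2` restricted to `3 ≤ |S|`).

* `cag_of_half_b2set2` — induction on `|A|` from (II′-set) for `|S| ≥ 2` (spectator = any relay other than the minimiser `a₀`, which stays in `S`,
  so the kernel may assume `τ(s₀) ≤ τ_c`).
* `additiveGluing_of_b2set2` — **(II′-set)_{|S| ≥ 2} ⟹ `AdditiveGluing`** (the two-stub form with `stub_k0_dp` for |S| = 2 follows with the shape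
  conversion `k0set_pair_of_k0` of `…SetGlueK0Closed.lean`; registered alternative |S| ≥ 3 stub: `stub_b2set3_g2`).
[cite: KozmaNitzan2024, Theorem 1 / (6) (pp. 7–8), Lemma 4 (p. 9), Question 7 (p. 36), §5.3 (p. 34)]
-/

namespace Summit.CriticalPhenomena.PercolationContinuityZ3.Theorems

open MeasureTheory Set Literature.Probability.LatticeModels Literature.Probability.Percolation

noncomputable section
open Classical

variable {n : ℕ}

/-- **CAG for every relay set from (II′-set) for `|S| ≥ 2`** (given the pulled-back half Theorem 1 `hHalf`, e.g. `setGlue_half`), by induction on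
`|A|` exactly as `cag_of_half_k0set2`, but feeding `cag_insert_of_setHalf` directly. [cite: KozmaNitzan2024, Lemma 4 (p. 9), Question 7 (p. 36)] -/
theorem cag_of_half_b2set2
    (hHalf : ∀ (n : ℕ) (w : Sym2 (Fin n) → unitInterval) (S : Finset (Fin n)) (o b c : Fin n), S.Nonempty → c ∉ S →
      (prodBernoulli w).real ((⋃ s ∈ S, (openConn c s : Set (BondConfig (Fin n))))ᶜ ∩ openConn o c) *
          ((prodBernoulli w).real ((⋃ s ∈ S, (openConn c s : Set (BondConfig (Fin n))))ᶜ ∩ openConn c b) -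
            (prodBernoulli w).real ((⋃ s ∈ S, (openConn c s : Set (BondConfig (Fin n))))ᶜ ∩
              (⋃ s ∈ S, (openConn s b : Set (BondConfig (Fin n)))))) ≤
        (prodBernoulli w).real ((⋃ s ∈ S, (openConn c s : Set (BondConfig (Fin n))))ᶜ) *
          ((prodBernoulli w).real
              ((openConn o b ∪ ((⋃ s ∈ S, (openConn o s : Set (BondConfig (Fin n)))) ∩
                  (⋃ s ∈ S, (openConn s b : Set (BondConfig (Fin n)))))) ∩
                (openConn o c ∪ ⋃ s ∈ S, (openConn o s : Set (BondConfig (Fin n))))) -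
            (prodBernoulli w).real ((openConn o c ∪ ⋃ s ∈ S, (openConn o s : Set (BondConfig (Fin n)))) ∩
              (⋃ s ∈ S, (openConn s b : Set (BondConfig (Fin n)))))))
    (hB : ∀ (n : ℕ) (w : Sym2 (Fin n) → unitInterval) (S : Finset (Fin n)) (o b c s₀ : Fin n), 2 ≤ S.card → s₀ ∈ S → c ∉ S →
      (∀ s ∈ S, (prodBernoulli w).real (openConn s₀ b) ≤ (prodBernoulli w).real (openConn s b)) →
      (prodBernoulli w).real (openConn s₀ b) ≤ (prodBernoulli w).real (openConn c b) →
      (prodBernoulli w).real ((⋃ s ∈ S, (openConn c s : Set (BondConfig (Fin n))))ᶜ ∩ openConn o c) *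
          ((prodBernoulli w).real (⋃ s ∈ S, (openConn s b : Set (BondConfig (Fin n)))) -
            (prodBernoulli w).real (openConn c b) -
            (prodBernoulli w).real ((openConn c b)ᶜ ∩ (⋃ s ∈ S, (openConn c s : Set (BondConfig (Fin n)))) ∩
              (⋃ s ∈ S, (openConn s b : Set (BondConfig (Fin n)))))) ≤
        (prodBernoulli w).real ((⋃ s ∈ S, (openConn c s : Set (BondConfig (Fin n))))ᶜ) *
          ((prodBernoulli w).real (⋃ s ∈ S, (openConn s b : Set (BondConfig (Fin n)))) -
              (prodBernoulli w).real (openConn s₀ b) +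
            (prodBernoulli w).real ((openConn o c ∪ ⋃ s ∈ S, (openConn o s : Set (BondConfig (Fin n))))ᶜ ∩ openConn c b ∩
              (⋃ s ∈ S, (openConn s b : Set (BondConfig (Fin n))))ᶜ) -
            (prodBernoulli w).real ((openConn o b)ᶜ ∩ (⋃ s ∈ S, (openConn o s : Set (BondConfig (Fin n)))) ∩
              (⋃ s ∈ S, (openConn s b : Set (BondConfig (Fin n))))))) :
    ∀ (m : ℕ) (n : ℕ) (w : Sym2 (Fin n) → unitInterval) (A : Finset (Fin n)) (o b a₀ : Fin n), A.card = m → a₀ ∈ A →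
      (∀ a ∈ A, (prodBernoulli w).real (openConn a₀ b) ≤ (prodBernoulli w).real (openConn a b)) →
      (prodBernoulli w).real ((⋃ a ∈ A, (openConn o a : Set (BondConfig (Fin n)))) ∩ (openConn o b)ᶜ ∩
          (⋃ a ∈ A, (openConn a b : Set (BondConfig (Fin n))))) ≤
        (prodBernoulli w).real (⋃ a ∈ A, (openConn a b : Set (BondConfig (Fin n)))) - (prodBernoulli w).real (openConn a₀ b) := by
  intro m
  induction m with
  | zero =>
    intro n w A o b a₀ hcard ha₀ _
    rw [Finset.card_eq_zero] at hcard
    rw [hcard] at ha₀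
    exact absurd ha₀ (Finset.notMem_empty a₀)
  | succ m ih =>
    intro n w A o b a₀ hcard ha₀ hmin
    by_cases hT : A.erase a₀ = ∅
    · have hA : A = {a₀} := by
        rw [← Finset.insert_erase ha₀, hT]
        rfl
      subst hA
      have hsub : ((⋃ a ∈ ({a₀} : Finset (Fin n)), (openConn o a : Set (BondConfig (Fin n)))) ∩ (openConn o b)ᶜ ∩
          (⋃ a ∈ ({a₀} : Finset (Fin n)), (openConn a b : Set (BondConfig (Fin n))))) ⊆ (∅ : Set (BondConfig (Fin n))) := by
        intro ω hω
        simp only [Set.mem_inter_iff, Set.mem_compl_iff, Set.mem_iUnion, exists_prop, Finset.mem_singleton] at hω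
        obtain ⟨⟨⟨a, ha, h1⟩, h2⟩, ⟨a', ha', h3⟩⟩ := hω
        rw [ha] at h1
        rw [ha'] at h3
        exact h2 (SimpleGraph.Reachable.trans h1 h3)
      have h0 := measureReal_mono (μ := prodBernoulli w) hsub (measure_ne_top _ _)
      rw [measureReal_empty] at h0
      have : (prodBernoulli w).real (openConn a₀ b) ≤
          (prodBernoulli w).real (⋃ a ∈ ({a₀} : Finset (Fin n)), (openConn a b : Set (BondConfig (Fin n)))) := by
        refine measureReal_mono (fun ω hω => ?_) (measure_ne_top _ _)
        simp only [Set.mem_iUnion, exists_prop, Finset.mem_singleton]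
        exact ⟨a₀, rfl, hω⟩
      linarith
    · obtain ⟨c, hc⟩ := Finset.nonempty_of_ne_empty hT
      have hcA : c ∈ A := Finset.mem_of_mem_erase hc
      have hca : c ≠ a₀ := Finset.ne_of_mem_erase hc
      set S := A.erase c with hSdef
      have ha₀S : a₀ ∈ S := Finset.mem_erase.2 ⟨hca.symm, ha₀⟩
      have hcS : c ∉ S := Finset.notMem_erase c A
      have hScard : S.card = m := by
        rw [hSdef, Finset.card_erase_of_mem hcA, hcard]
        rfl
      have hminS : ∀ s ∈ S, (prodBernoulli w).real (openConn a₀ b) ≤ (prodBernoulli w).real (openConn s b) :=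
        fun s hs => hmin s (Finset.mem_of_mem_erase hs)
      have hIH := ih n w S o b a₀ hScard ha₀S hminS
      have hBi : (prodBernoulli w).real ((⋃ s ∈ S, (openConn c s : Set (BondConfig (Fin n))))ᶜ ∩ openConn o c) *
          ((prodBernoulli w).real (⋃ s ∈ S, (openConn s b : Set (BondConfig (Fin n)))) -
            (prodBernoulli w).real (openConn c b) -
            (prodBernoulli w).real ((openConn c b)ᶜ ∩ (⋃ s ∈ S, (openConn c s : Set (BondConfig (Fin n)))) ∩
              (⋃ s ∈ S, (openConn s b : Set (BondConfig (Fin n)))))) ≤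
        (prodBernoulli w).real ((⋃ s ∈ S, (openConn c s : Set (BondConfig (Fin n))))ᶜ) *
          ((prodBernoulli w).real (⋃ s ∈ S, (openConn s b : Set (BondConfig (Fin n)))) -
              (prodBernoulli w).real (openConn a₀ b) +
            (prodBernoulli w).real ((openConn o c ∪ ⋃ s ∈ S, (openConn o s : Set (BondConfig (Fin n))))ᶜ ∩ openConn c b ∩
              (⋃ s ∈ S, (openConn s b : Set (BondConfig (Fin n))))ᶜ) -
            (prodBernoulli w).real ((openConn o b)ᶜ ∩ (⋃ s ∈ S, (openConn o s : Set (BondConfig (Fin n)))) ∩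
              (⋃ s ∈ S, (openConn s b : Set (BondConfig (Fin n)))))) := by
        rcases Nat.lt_or_ge S.card 2 with hlt | h2
        · -- `S = {a₀}`: `τ_c ≥ τ(a₀)`, both gluing gains vanish, `ROOM_S ≥ 0`
          have hS1 : S.card = 1 := by
            have hSpos : 0 < S.card := Finset.card_pos.2 ⟨a₀, ha₀S⟩
            omega
          obtain ⟨a, ha⟩ := Finset.card_eq_one.1 hS1
          have haa : a₀ = a := by
            have : a₀ ∈ ({a} : Finset (Fin n)) := ha ▸ ha₀S
            exact Finset.mem_singleton.1 this
          rw [ha, ← haa]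
          simp only [Finset.set_biUnion_singleton]
          have hΓ : ∀ x : Fin n, (prodBernoulli w).real ((openConn x b)ᶜ ∩ openConn x a₀ ∩ openConn a₀ b :
              Set (BondConfig (Fin n))) = 0 := by
            intro x
            have hsub : ((openConn x b)ᶜ ∩ openConn x a₀ ∩ openConn a₀ b : Set (BondConfig (Fin n))) ⊆ ∅ := by
              rintro ω ⟨⟨h1, h2⟩, h3⟩
              exact h1 (SimpleGraph.Reachable.trans h2 h3)
            have h0 := measureReal_mono (μ := prodBernoulli w) hsub (measure_ne_top _ _)
            rw [measureReal_empty] at h0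
            exact le_antisymm h0 measureReal_nonneg
          rw [hΓ c, hΓ o]
          have hψ : (prodBernoulli w).real ((openConn c a₀)ᶜ ∩ openConn o c : Set (BondConfig (Fin n))) ≤
              (prodBernoulli w).real ((openConn c a₀)ᶜ : Set (BondConfig (Fin n))) :=
            measureReal_mono Set.inter_subset_left (measure_ne_top _ _)
          have hψ0 : 0 ≤ (prodBernoulli w).real ((openConn c a₀)ᶜ ∩ openConn o c : Set (BondConfig (Fin n))) := measureReal_nonneg
          have hR : 0 ≤ (prodBernoulli w).real ((openConn o c ∪ openConn o a₀)ᶜ ∩ openConn c b ∩ (openConn a₀ b)ᶜ :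
              Set (BondConfig (Fin n))) := measureReal_nonneg
          have hD0 : 0 ≤ (prodBernoulli w).real ((openConn c a₀)ᶜ : Set (BondConfig (Fin n))) := measureReal_nonneg
          have hτ := hmin c hcA
          nlinarith [mul_le_mul_of_nonneg_right hψ (sub_nonneg.2 hτ), mul_nonneg hD0 hR, mul_nonneg hψ0 (sub_nonneg.2 hτ)]
        · exact hB n w S o b c a₀ h2 ha₀S hcS hminS (hmin c hcA)
      have hres := cag_insert_of_setHalf w S o b c ((prodBernoulli w).real (openConn a₀ b))
        (hHalf n w S o b c ⟨a₀, ha₀S⟩ hcS) hIH hBi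
      have hAe : A = insert c S := by rw [hSdef, Finset.insert_erase hcA]
      rw [hAe, Finset.set_biUnion_insert, Finset.set_biUnion_insert]
      exact hres

/-- **(II′-set) for `|S| ≥ 2` ⟹ `AdditiveGluing`** (the weaker set kernel; `|S| = 2` included).  With the pulled-back half Theorem 1
`setGlue_half` (…SetGlueHalf.lean) and `cag_of_half_b2set2`.  The two-stub form — (K₀) = `stub_k0_dp` for `|S| = 2` plus (II′-set) for `|S| ≥ 3`
(registered alternative stub `stub_b2set3_g2`) — follows with the shape conversion `k0set_pair_of_k0` of `…SetGlueK0Closed.lean`.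
[cite: KozmaNitzan2024, Conjecture 1 (p. 3), Theorem 1 (pp. 7–8), Lemma 4 (p. 9), Question 7 (p. 36), §5.3 (p. 34)] -/
theorem additiveGluing_of_b2set2
    (hB : ∀ (n : ℕ) (w : Sym2 (Fin n) → unitInterval) (S : Finset (Fin n)) (o b c s₀ : Fin n), 2 ≤ S.card → s₀ ∈ S → c ∉ S →
      (∀ s ∈ S, (prodBernoulli w).real (openConn s₀ b) ≤ (prodBernoulli w).real (openConn s b)) →
      (prodBernoulli w).real (openConn s₀ b) ≤ (prodBernoulli w).real (openConn c b) →
      (prodBernoulli w).real ((⋃ s ∈ S, (openConn c s : Set (BondConfig (Fin n))))ᶜ ∩ openConn o c) *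
          ((prodBernoulli w).real (⋃ s ∈ S, (openConn s b : Set (BondConfig (Fin n)))) -
            (prodBernoulli w).real (openConn c b) -
            (prodBernoulli w).real ((openConn c b)ᶜ ∩ (⋃ s ∈ S, (openConn c s : Set (BondConfig (Fin n)))) ∩
              (⋃ s ∈ S, (openConn s b : Set (BondConfig (Fin n)))))) ≤
        (prodBernoulli w).real ((⋃ s ∈ S, (openConn c s : Set (BondConfig (Fin n))))ᶜ) *
          ((prodBernoulli w).real (⋃ s ∈ S, (openConn s b : Set (BondConfig (Fin n)))) -
              (prodBernoulli w).real (openConn s₀ b) +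
            (prodBernoulli w).real ((openConn o c ∪ ⋃ s ∈ S, (openConn o s : Set (BondConfig (Fin n))))ᶜ ∩ openConn c b ∩
              (⋃ s ∈ S, (openConn s b : Set (BondConfig (Fin n))))ᶜ) -
            (prodBernoulli w).real ((openConn o b)ᶜ ∩ (⋃ s ∈ S, (openConn o s : Set (BondConfig (Fin n)))) ∩
              (⋃ s ∈ S, (openConn s b : Set (BondConfig (Fin n))))))) :
    Summit.CriticalPhenomena.PercolationContinuityZ3.Theses.PercNearOneGluing.AdditiveGluing :=
  additiveGluing_of_cag fun n w A o b a₀ ha₀ hmin => cag_of_half_b2set2 setGlue_half hB A.card n w A o b a₀ rfl ha₀ hmin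

end

end Summit.CriticalPhenomena.PercolationContinuityZ3.Theorems
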